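import Literature.NumberTheory.EllipticCurves.Kato2004.IwasawaCohomologyNumberFieldTwistSum
import Literature.NumberTheory.EllipticCurves.TateModuleQuadraticTwistEquivProofs
import Literature.NumberTheory.EllipticCurves.ZpExtensionRestrictTwoSqrtTwo
import Literature.NumberTheory.EllipticCurves.HeegnerPointsImaginaryQuadraticProofs
import Literature.NumberTheory.EllipticCurves.BSDSelmerParityDokchitserTowerProofs
import Literature.NumberTheory.QuadraticFields.SquareRootGenerator
import Literature.NumberTheory.QuadraticFields.KroneckerSplitting
import Mathlib.NumberTheory.Padics.Hensel
import Mathlib.NumberTheory.Padics.HeightOneSpectrum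
import Summits.BirchSwinnertonDyer.BirchSwinnertonDyer.Theorems.AdditiveBranchIMCGreenbergVatsalResidualBranchTransport
import HarnessLib

/-!
# Route `TwoAdicConverse` (rung S3), crux `OrdLambdaHalfAtTwo` (item stmt-BirchSwinnertonDyer-19556), line
# `kato-determinant-greenberg-two`, stub 4‴ `ThetaShapiroKatoGreenbergSupplyAtTwo`: the SHAPIRO-LATTICE CLAUSES are THEOREMS —
# `L := loc_w̄ 𝐇¹_{K,Γ}(T₂W_K)` with `range(loc_W ⊕ u_A loc_A) ≤ L` and `2·L ≤ range(loc_W ⊕ u_A loc_A)`, given the split place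

Seat `bsd-2adic-conv-1` GEN 30 (prover, cell `pub/bsd-2adic`; `--supports stmt-BirchSwinnertonDyer-19556`).  HONEST FRAMING: BSD is not
proved by any of this; the crux `OrdLambdaHalfAtTwo` is NOT proved here; nothing about any particular curve is asserted; no named fact; theorems only.

The v4.5/v4.6 datum `ThetaShapiroKatoGreenbergDatum` of the line carries a lattice `L ≤ 𝐇¹_loc(T₂W)` with two clauses, `range_le :
range(loc_W ⊕ (𝐇¹(u_A) ∘ loc_A)) ≤ L` and `two_smul_mem : 2·L ≤ range(loc_W ⊕ (𝐇¹(u_A) ∘ loc_A))`, intended for `L = loc_w̄ H¹_Iw(K_Σ/K, T₂W)`.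
With the K-carrier vocabulary of `Literature/…/Kato2004/IwasawaCohomologyNumberField{,Restriction,Loc,Corestriction,ResCor,TwistModel,Twist,
TwistSum}.lean` (conv-1 GEN 29/30) both clauses are KERNEL THEOREMS for the genuine `L := range (IK.locOver J …)`, modulo ONE explicit
hypothesis, the splitting datum `hD : D_v ≤ galRange K` of the local file (`v` split in `K`; for the habitat's `v = 2` this is the Heegner
hypothesis at `2`, to be discharged from `SatisfiesHeegnerHypothesis (2N) K` — tree `stabilizer_le_of_mem_splitPrimes` is the nearest brick).
This file discharges every OTHER side condition from the habitat `IsImaginaryQuadratic K`, `C • A = W^{(d_K)}`: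

* §1 `sq_ne_two` (`√2 ∉ K`: else `d_K = 2q² > 0`), `surjective_comp_absGaloisRestrict_two` (`κ ∘ res_{K/ℚ}` onto for the cyclotomic `κ` at
  `2`, tree `surjective_comp_absGaloisRestrict_of_forall_sq_ne_two`), `exists_sq_eq_discr` (`√d_K ∈ K ∖ ℚ`), `mem_galRange_iff_discr`
  (`σ ∈ galRange K ↔ σ√d_K = √d_K`), `normal_galRange_of_isImaginaryQuadratic`;
* §2 `exists_twist_equiv` — the integral twist isomorphism `u : T_pA ≃ T_pW`, continuous, `galRange K`-equivariant and anti-equivariant off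
  `galRange K` (`WeierstrassCurve.exists_tateModule_equiv_of_smul_eq_quadraticTwist`);
* §3 **`exists_shapiroLattice`** — for every prime `p`, every cyclotomic `κ` with `κ ∘ res` onto, pins `I_W, I_A`, local pins `J, J_A` at a place
  `v` with `hD`: there are the local untwisting `u_A : T_pA|_{Γ_{ℚ_v}} ⟶ T_pW|_{Γ_{ℚ_v}}` and `L ≤ J.H` with BOTH clauses, and `L` IS
  `range (IK.locOver J …)` for a `K`-pin `IK` (recorded in the conclusion); **`exists_shapiroLattice_two`** — the `p = 2` habitat form
  (surjectivity discharged by §1).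

References: R. Greenberg, LNM 1716 (1999) §4 p. 107 [GreenbergLNM1716]; K. Kato, Astérisque 295 (2004) §17.13 [Kato2004Asterisque];
J. Neukirch, A. Schmidt, K. Wingberg (2008) I §5 [NeukirchSchmidtWingberg2008]; J. H. Silverman, *AEC* (2009) X.5 Cor. 5.4 [SilvermanAEC2009];
L. Washington, GTM 83 §13.1 [Washington1997]; D. A. Marcus, *Number Fields*, Ch. 2 [Marcus1977].
-/

set_option linter.dupNamespace false

noncomputable section

open scoped NumberField
open Field IsDedekindDomain WeierstrassCurve
open Literature.NumberTheory.GaloisRepresentations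
open Literature.NumberTheory.EllipticCurves Literature.NumberTheory.EllipticCurves.Kato2004
open Literature.NumberTheory.EllipticCurves.Kato2004.EulerSystemValues

namespace Summit.BirchSwinnertonDyer.BirchSwinnertonDyer.Theorems.TwoAdicShapiroLattice

/-! ## §1 The imaginary quadratic field `K`: `√2 ∉ K`, `√d_K ∈ K`, `galRange K = Stab(√d_K)` is normal -/

section Field

variable (K : Type) [Field K] [NumberField K]

/-- **`√2 ∉ K` for an imaginary quadratic `K`**: a solution of `x² = 2` in `K` is irrational, so `K = ℚ(x)` and `d_K = 2·q²`
(`NumberField.exists_discr_eq_mul_sq`) would be positive, against `d_K < 0` (`IsImaginaryQuadratic.discr_neg`). [cite: Marcus1977, Ch. 2 Thm. 1] -/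
theorem sq_ne_two (hK : IsImaginaryQuadratic K) (x : K) : x ^ 2 ≠ 2 := by
  intro hx
  have hx' : x ^ 2 = algebraMap ℚ K 2 := by rw [hx, map_ofNat]
  have hxK : x ∉ Set.range (algebraMap ℚ K) := by
    rintro ⟨q, rfl⟩
    have hq : (q : ℝ) ^ 2 = 2 := by
      rw [← map_pow] at hx'
      have := (algebraMap ℚ K).injective hx'
      exact_mod_cast congrArg (fun r : ℚ ↦ (r : ℝ)) this
    refine irrational_sqrt_two ⟨|q|, ?_⟩
    rw [Rat.cast_abs, ← Real.sqrt_sq_eq_abs, hq]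
  obtain ⟨q, hq0, hq⟩ := NumberField.exists_discr_eq_mul_sq hK.1 hxK hx'
  have hneg : (NumberField.discr K : ℚ) < 0 := by exact_mod_cast hK.discr_neg
  have hpos : (0 : ℚ) < 2 * q ^ 2 := by positivity
  linarith

/-- **`κ ∘ res_{K/ℚ}` is onto for the cyclotomic `ℤ₂`-extension and an imaginary quadratic `K`** (`K ∩ ℚ_∞ = ℚ`: `[K:ℚ] = 2`, `√2 ∉ K`;
tree `surjective_comp_absGaloisRestrict_of_forall_sq_ne_two`). [cite: Washington1997, §13.1] -/
theorem surjective_comp_absGaloisRestrict_two (hK : IsImaginaryQuadratic K) (κ : ZpExtension ℚ 2) (hκ : κ.IsCyclotomic) :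
    Function.Surjective (κ.toContinuousMonoidHom.comp (absGaloisRestrict ℚ K)) :=
  ZpExtension.surjective_comp_absGaloisRestrict_of_forall_sq_ne_two κ K hκ (by rw [hK.1]; decide) (sq_ne_two K hK)

/-- **`√d_K ∈ K ∖ ℚ`**: a quadratic field has a square-root generator `θ`, `θ² = c` (`exists_sq_eq_algebraMap`), and `d_K = c q²`
(`NumberField.exists_discr_eq_mul_sq`), so `(qθ)² = d_K`. [cite: Marcus1977, Ch. 2 Thm. 1 and Exercise 2.8] -/
theorem exists_sq_eq_discr (h2 : Module.finrank ℚ K = 2) :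
    ∃ θ : K, θ ∉ Set.range (algebraMap ℚ K) ∧ θ ^ 2 = algebraMap ℚ K ((NumberField.discr K : ℤ) : ℚ) := by
  obtain ⟨θ, c, hθ, hc⟩ := Literature.NumberTheory.QuadraticFields.Quadratic.exists_sq_eq_algebraMap (F := ℚ) (K := K) h2
  obtain ⟨q, hq0, hq⟩ := NumberField.exists_discr_eq_mul_sq h2 hθ hc
  refine ⟨algebraMap ℚ K q * θ, ?_, ?_⟩
  · rintro ⟨r, hr⟩
    apply hθ
    refine ⟨r / q, ?_⟩
    rw [map_div₀, hr, mul_div_cancel_left₀ _ ((_root_.map_ne_zero _).mpr hq0)]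
  · rw [mul_pow, hc, ← map_pow, ← map_mul, hq, mul_comm]

/-- **`σ ∈ galRange K ↔ σ√d_K = √d_K`** for a quadratic `K` (the tree's `mem_galRange_iff_smul_geomSqrt_eq` at `θ = √d_K ∈ K`).
[cite: Marcus1977, Ch. 2 Thm. 1] -/
theorem mem_galRange_iff_discr (h2 : Module.finrank ℚ K = 2) (σ : absoluteGaloisGroup ℚ) :
    σ ∈ galRange (K := ℚ) K ↔ σ • geomSqrt ((NumberField.discr K : ℤ) : ℚ) = geomSqrt ((NumberField.discr K : ℤ) : ℚ) := by
  obtain ⟨θ, hθK, hθ⟩ := exists_sq_eq_discr K h2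
  exact AdditiveBranchIMCGreenbergVatsalResidualBranchTransport.mem_galRange_iff_smul_geomSqrt_eq K h2 hθK hθ σ

/-- `galRange K` is the stabiliser of `√d_K`. [cite: Marcus1977, Ch. 2 Thm. 1] -/
theorem galRange_eq_stabilizer_discr (h2 : Module.finrank ℚ K = 2) :
    galRange (K := ℚ) K = MulAction.stabilizer (absoluteGaloisGroup ℚ) (geomSqrt ((NumberField.discr K : ℤ) : ℚ)) := by
  ext σ
  rw [mem_galRange_iff_discr K h2, MulAction.mem_stabilizer_iff]

/-- **`galRange K ⊴ Γ_ℚ` for a quadratic field `K`** (the stabiliser of `√d` is normal, `stabilizer_geomSqrt_normal`). [cite: Marcus1977, Ch. 2] -/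
theorem normal_galRange_of_finrank_eq_two (h2 : Module.finrank ℚ K = 2) : (galRange (K := ℚ) K).Normal := by
  rw [galRange_eq_stabilizer_discr K h2]
  exact stabilizer_geomSqrt_normal _

end Field

/-! ## §2 The integral twist isomorphism `u : T_pA ≃ T_pW` for `C • A = W^{(d_K)}` -/

section Twist

variable (K : Type) [Field K] [NumberField K] (p : ℕ) [Fact p.Prime]

/-- **The twist isomorphism of Tate modules** for a model `A` of the quadratic twist of `W` by `K` (`C • A = W^{(d_K)}`): a continuous
`ℤ_p`-linear `u : T_pA ≃ T_pW`, continuous inverse, `u(σx) = σu(x)` for `σ ∈ galRange K` and `u(σx) = −σu(x)` for `σ ∉ galRange K`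
(`WeierstrassCurve.exists_tateModule_equiv_of_smul_eq_quadraticTwist` + `mem_galRange_iff_discr`). [cite: SilvermanAEC2009, X.5 Cor. 5.4] -/
theorem exists_twist_equiv (h2 : Module.finrank ℚ K = 2) (W A : WeierstrassCurve ℚ) (C : VariableChange ℚ)
    (hA : C • A = W.quadraticTwist ((NumberField.discr K : ℤ) : ℚ)) :
    ∃ u : A.tateModule p ≃ₗ[ℤ_[p]] W.tateModule p, Continuous u ∧ Continuous u.symm ∧
      (∀ σ : absoluteGaloisGroup ℚ, σ ∈ galRange (K := ℚ) K → ∀ x : A.tateModule p, u (σ • x) = σ • u x) ∧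
      (∀ σ : absoluteGaloisGroup ℚ, σ ∉ galRange (K := ℚ) K → ∀ x : A.tateModule p, u (σ • x) = -(σ • u x)) := by
  have hd : ((NumberField.discr K : ℤ) : ℚ) ≠ 0 := by exact_mod_cast NumberField.discr_ne_zero K
  obtain ⟨u, hc, hc', h₁, h₂⟩ := W.exists_tateModule_equiv_of_smul_eq_quadraticTwist A C hd hA p
  refine ⟨u, hc, hc', fun σ hσ ↦ h₁ σ ((mem_galRange_iff_discr K h2 σ).mp hσ), fun σ hσ ↦ h₂ σ ?_⟩
  rcases map_geomSqrt (absoluteGaloisGroup.toAlgEquiv ℚ σ) ((NumberField.discr K : ℤ) : ℚ) with h | h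
  · exact absurd ((mem_galRange_iff_discr K h2 σ).mpr h) hσ
  · exact h

end Twist

/-! ## §3 The Shapiro lattice with its two clauses -/

section Lattice

variable {K : Type} [Field K] [NumberField K] {p : ℕ} [Fact p.Prime]
  {W A : WeierstrassCurve ℚ} [W.IsElliptic] [A.IsElliptic] [ContinuousSMul ℤ_[p] (W.tateModule p)] [ContinuousSMul ℤ_[p] (A.tateModule p)]
  [ContinuousSMul ℤ_[p] ((W.baseChange K).tateModule p)]
  {κ : ZpExtension ℚ p} {γ : absoluteGaloisGroup ℚ} {v : HeightOneSpectrum (𝓞 ℚ)} {γᵥ : absoluteGaloisGroup (v.adicCompletion ℚ)}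

/-- **The Shapiro lattice with both clauses, any `p`.**  For a quadratic `K`, a model `A` of `W^{(d_K)}`, a `ℤ_p`-extension `κ` of `ℚ` with
`κ ∘ res_{K/ℚ}` onto and topological generator `γ`, a place `v` whose decomposition group lies in `galRange K` (`hD`; `v` split in `K`) with
`κ ∘ res_v` onto and local generator `γᵥ`, Kato pins `I_W, I_A` and local pins `J, J_A`: there are a local untwisting `u_A : T_pA|_v ⟶ T_pW|_v` and
`L ≤ 𝐇¹_loc(T_pW)` with `range(loc_W ⊕ 𝐇¹(u_A) loc_A) ≤ L` and `2·L ≤ range(loc_W ⊕ 𝐇¹(u_A) loc_A)`, `L` BEING `loc_w̄ 𝐇¹_{K,Γ}(T_pW_K)`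
(`range IK.locOver` for a `K`-pin `IK` of the tower `κ.restrict K h`).  Kernel: `range_coprod_loc_le_range_locOver`,
`two_smul_mem_range_coprod_loc_of_mem_range_locOver` (file `…TwistSum`). [cite: GreenbergLNM1716, §4 p. 107] [cite: Kato2004Asterisque, §17.13 (17.13.1)] -/
theorem exists_shapiroLattice (h2 : Module.finrank ℚ K = 2) (C : VariableChange ℚ)
    (hA : C • A = W.quadraticTwist ((NumberField.discr K : ℤ) : ℚ))
    (h : Function.Surjective (κ.toContinuousMonoidHom.comp (absGaloisRestrict ℚ K))) (hγ : κ.IsTopGenerator γ)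
    (hD : ∀ g : absoluteGaloisGroup (v.adicCompletion ℚ),
      resGalOfEmb (closureEmb (K := ℚ) (v.adicCompletion ℚ)) g ∈ galRange (K := ℚ) K)
    (hsurjv : Function.Surjective
      (κ.toContinuousMonoidHom.comp (resGalOfEmb (closureEmb (K := ℚ) (v.adicCompletion ℚ)))))
    (hγᵥ : κ.IsTopGenerator (resGalOfEmb (closureEmb (K := ℚ) (v.adicCompletion ℚ)) γᵥ))
    (I_W : IwasawaH1Data W p κ γ) (I_A : IwasawaH1Data A p κ γ)
    (J : LocalIwasawaH1Data κ v ((tateRep W p).toLocal v) γᵥ) (J_A : LocalIwasawaH1Data κ v ((tateRep A p).toLocal v) γᵥ) :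
    ∃ (uA : ((tateRep A p).toLocal v).toTopRep ⟶ ((tateRep W p).toLocal v).toTopRep), Function.Bijective uA.hom ∧
      ∃ (L : Submodule (IwasawaAlgebra p) J.H),
      LinearMap.range ((I_W.loc J hsurjv hγ hγᵥ).coprod (J_A.map uA J ∘ₗ I_A.loc J_A hsurjv hγ hγᵥ)) ≤ L ∧
      (∀ y ∈ L, (2 : IwasawaAlgebra p) • y ∈
        LinearMap.range ((I_W.loc J hsurjv hγ hγᵥ).coprod (J_A.map uA J ∘ₗ I_A.loc J_A hsurjv hγ hγᵥ))) ∧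
      ∃ (γK : absoluteGaloisGroup K) (hγK : (κ.restrict K h).IsTopGenerator γK)
        (IK : IwasawaH1DataOver (W.baseChange K) p (κ.restrict K h) γK), L = LinearMap.range (IK.locOver J hD hsurjv hγK hγᵥ) := by
  haveI : (galRange (K := ℚ) K).Normal := normal_galRange_of_finrank_eq_two K h2
  obtain ⟨u, hu, hu', hu₁, hu₂⟩ := exists_twist_equiv K p h2 W A C hA
  obtain ⟨γK, hγK⟩ := ZpExtension.exists_isTopGenerator (κ.restrict K h)
  obtain ⟨IK⟩ := nonempty_iwasawaH1DataOver (V := W.baseChange K) (p := p) (κ := κ.restrict K h) hγK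
  have hbij : Function.Bijective (localTwistHom v hD W A u hu hu₁).hom := by
    have hcoe : ⇑(localTwistHom v hD W A u hu hu₁).hom = ⇑u := funext fun x ↦ localTwistHom_hom_apply v hD W A u hu hu₁ x
    rw [hcoe]
    exact u.bijective
  refine ⟨localTwistHom v hD W A u hu hu₁, hbij, LinearMap.range (IK.locOver J hD hsurjv hγK hγᵥ),
    IK.range_coprod_loc_le_range_locOver u hu hu₁ I_A J J_A I_W hsurjv hγ hγK hγᵥ,
    fun y hy ↦ IK.two_smul_mem_range_coprod_loc_of_mem_range_locOver u hu hu' hu₁ hu₂ I_A J J_A I_W hsurjv hγ hγK hγᵥ hy,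
    γK, hγK, IK, rfl⟩

/-- **The Shapiro lattice with both clauses at `p = 2` in the habitat** (`K` imaginary quadratic, `κ` the cyclotomic `ℤ₂`-extension of `ℚ`):
as `exists_shapiroLattice`, with the surjectivity of `κ ∘ res_{K/ℚ}` DISCHARGED (`surjective_comp_absGaloisRestrict_two`).  This is the content of the
clauses `range_le` / `two_smul_mem` of stub 4‴ `ThetaShapiroKatoGreenbergSupplyAtTwo` for `L := loc_w̄ 𝐇¹_{K,Γ}(T₂W_K)`, modulo the splitting
datum `hD` at the chosen place. [cite: GreenbergLNM1716, §4 p. 107] [cite: Kato2004Asterisque, §17.13 (17.13.1)] -/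
theorem exists_shapiroLattice_two {K : Type} [Field K] [NumberField K] (hK : IsImaginaryQuadratic K)
    {W A : WeierstrassCurve ℚ} [W.IsElliptic] [A.IsElliptic] [ContinuousSMul ℤ_[2] (W.tateModule 2)]
    [ContinuousSMul ℤ_[2] (A.tateModule 2)] [ContinuousSMul ℤ_[2] ((W.baseChange K).tateModule 2)]
    (C : VariableChange ℚ) (hA : C • A = W.quadraticTwist ((NumberField.discr K : ℤ) : ℚ))
    {κ : ZpExtension ℚ 2} (hκ : κ.IsCyclotomic) {γ : absoluteGaloisGroup ℚ} (hγ : κ.IsTopGenerator γ)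
    {v : HeightOneSpectrum (𝓞 ℚ)} {γᵥ : absoluteGaloisGroup (v.adicCompletion ℚ)}
    (hD : ∀ g : absoluteGaloisGroup (v.adicCompletion ℚ),
      resGalOfEmb (closureEmb (K := ℚ) (v.adicCompletion ℚ)) g ∈ galRange (K := ℚ) K)
    (hsurjv : Function.Surjective
      (κ.toContinuousMonoidHom.comp (resGalOfEmb (closureEmb (K := ℚ) (v.adicCompletion ℚ)))))
    (hγᵥ : κ.IsTopGenerator (resGalOfEmb (closureEmb (K := ℚ) (v.adicCompletion ℚ)) γᵥ))
    (I_W : IwasawaH1Data W 2 κ γ) (I_A : IwasawaH1Data A 2 κ γ)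
    (J : LocalIwasawaH1Data κ v ((tateRep W 2).toLocal v) γᵥ) (J_A : LocalIwasawaH1Data κ v ((tateRep A 2).toLocal v) γᵥ) :
    ∃ (uA : ((tateRep A 2).toLocal v).toTopRep ⟶ ((tateRep W 2).toLocal v).toTopRep), Function.Bijective uA.hom ∧
      ∃ (L : Submodule (IwasawaAlgebra 2) J.H),
      LinearMap.range ((I_W.loc J hsurjv hγ hγᵥ).coprod (J_A.map uA J ∘ₗ I_A.loc J_A hsurjv hγ hγᵥ)) ≤ L ∧
      (∀ y ∈ L, (2 : IwasawaAlgebra 2) • y ∈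
        LinearMap.range ((I_W.loc J hsurjv hγ hγᵥ).coprod (J_A.map uA J ∘ₗ I_A.loc J_A hsurjv hγ hγᵥ))) ∧
      ∃ (h : Function.Surjective (κ.toContinuousMonoidHom.comp (absGaloisRestrict ℚ K)))
        (γK : absoluteGaloisGroup K) (hγK : (κ.restrict K h).IsTopGenerator γK)
        (IK : IwasawaH1DataOver (W.baseChange K) 2 (κ.restrict K h) γK), L = LinearMap.range (IK.locOver J hD hsurjv hγK hγᵥ) := by
  have h := surjective_comp_absGaloisRestrict_two K hK κ hκ
  obtain ⟨uA, hbij, L, h1, h2', γK, hγK, IK, hL⟩ :=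
    exists_shapiroLattice (p := 2) hK.1 C hA h hγ hD hsurjv hγᵥ I_W I_A J J_A
  exact ⟨uA, hbij, L, h1, h2', h, γK, hγK, IK, hL⟩

end Lattice

/-! ## §4 The splitting datum `hD` at the place `2` from the Heegner hypothesis (`2` split in `K`) -/

section Split

open Polynomial

/-- **`2`-adic Hensel: an integer `≡ 1 (mod 8)` is a square in `ℤ₂`** (`F = X² − d`, `a = 1`: `‖F(1)‖ ≤ 2⁻³ < 2⁻² = ‖F′(1)‖²`;
Mathlib `hensels_lemma`), stated for a prime `q = 2` (so that it applies to `ℤ_[primesEquiv v]`). [cite: Serre1973, Ch. II §3.3] -/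
theorem padicInt_exists_sq_eq_of_eq_two {q : ℕ} [Fact q.Prime] (hq : q = 2) {d : ℤ} (hd : (8 : ℤ) ∣ d - 1) :
    ∃ z : ℤ_[q], z ^ 2 = (d : ℤ_[q]) := by
  subst hq
  set F : ℤ[X] := X ^ 2 - C d with hF
  have hFa : F.aeval (1 : ℤ_[2]) = ((1 - d : ℤ) : ℤ_[2]) := by simp [hF]
  have hF' : F.derivative = C 2 * X := by
    rw [hF, derivative_sub, derivative_X_pow, derivative_C, sub_zero]; norm_num
  have hFa' : F.derivative.aeval (1 : ℤ_[2]) = (2 : ℤ_[2]) := by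
    rw [hF', map_mul, aeval_C, aeval_X, mul_one, map_ofNat]
  have hn1 : ‖F.aeval (1 : ℤ_[2])‖ ≤ (2 : ℝ) ^ (-3 : ℤ) := by
    rw [hFa]
    have : ((2 : ℕ) ^ 3 : ℤ) ∣ 1 - d := by
      obtain ⟨k, hk⟩ := hd
      exact ⟨-k, by norm_num; linarith⟩
    have h' := (PadicInt.norm_int_le_pow_iff_dvd (p := 2) (k := 1 - d) (n := 3)).mpr this
    exact_mod_cast h'
  have hd' : ‖F.derivative.aeval (1 : ℤ_[2])‖ = (2 : ℝ)⁻¹ := by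
    rw [hFa']
    exact_mod_cast PadicInt.norm_p (p := 2)
  have hnorm : ‖F.aeval (1 : ℤ_[2])‖ < ‖F.derivative.aeval (1 : ℤ_[2])‖ ^ 2 := by
    rw [hd']
    refine lt_of_le_of_lt hn1 ?_
    norm_num
  obtain ⟨z, hz, -⟩ := hensels_lemma hnorm
  have : F.aeval z = z ^ 2 - (d : ℤ_[2]) := by simp [hF]
  rw [this, sub_eq_zero] at hz
  exact ⟨z, hz⟩

/-- **`d_K` is a square in `ℚ₂` when `2` splits in the quadratic field `K`** (`d_K ≡ 1 (mod 8)`, tree `ncard_primesOver_two_eq_two_iff`; Hensel),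
in the completion `ℚ_v` of the tree at the place `v` of `ℚ` above `2` (transport along Mathlib's `adicCompletion.padicEquiv`).
[cite: Marcus1977, Ch. 3 Thm. 25] [cite: Serre1973, Ch. II §3.3] -/
theorem exists_sq_eq_discr_adicCompletion_two {K : Type} [Field K] [NumberField K] (h2 : Module.finrank ℚ K = 2)
    (hsplit : ((Ideal.span {(2 : ℤ)}).primesOver (𝓞 K)).ncard = 2)
    {v : HeightOneSpectrum (𝓞 ℚ)} (hv : ((Rat.HeightOneSpectrum.primesEquiv v : Nat.Primes) : ℕ) = 2) :
    ∃ t : v.adicCompletion ℚ, t ^ 2 = algebraMap ℚ (v.adicCompletion ℚ) ((NumberField.discr K : ℤ) : ℚ) := by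
  haveI : Fact (Nat.Prime ((Rat.HeightOneSpectrum.primesEquiv v : Nat.Primes) : ℕ)) := ⟨(Rat.HeightOneSpectrum.primesEquiv v).2⟩
  have hd8 : NumberField.discr K % 8 = 1 :=
    (Literature.NumberTheory.QuadraticFields.Quadratic.ncard_primesOver_two_eq_two_iff h2).mp hsplit
  have hdvd : (8 : ℤ) ∣ NumberField.discr K - 1 := ⟨NumberField.discr K / 8, by omega⟩
  obtain ⟨z, hz⟩ := padicInt_exists_sq_eq_of_eq_two hv hdvd
  refine ⟨(Rat.HeightOneSpectrum.adicCompletion.padicEquiv v).symm (z : ℚ_[(Rat.HeightOneSpectrum.primesEquiv v : ℕ)]), ?_⟩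
  have hz' : ((z : ℚ_[(Rat.HeightOneSpectrum.primesEquiv v : ℕ)])) ^ 2 =
      ((NumberField.discr K : ℤ) : ℚ_[(Rat.HeightOneSpectrum.primesEquiv v : ℕ)]) := by
    have := congrArg ((↑) : ℤ_[(Rat.HeightOneSpectrum.primesEquiv v : ℕ)] → ℚ_[(Rat.HeightOneSpectrum.primesEquiv v : ℕ)]) hz
    push_cast at this
    exact this
  rw [← map_pow, hz', map_intCast]
  exact (map_intCast (algebraMap ℚ (v.adicCompletion ℚ)) _).symm

/-- **The splitting datum `hD` at `2`**: if `2` splits in the quadratic field `K`, the decomposition group of the prime of `ℚ̄` cut out by the chosen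
embedding `ℚ̄ → ℚ̄_v` (`v ∣ 2`) lies in `galRange K` — every `res_v g` fixes `√d_K`, because `ι(√d_K) = ±t` with `t ∈ ℚ_v`, `t² = d_K`, is fixed by
`g ∈ Γ_{ℚ_v}` (`exists_sq_eq_discr_adicCompletion_two`, `apply_resGalAuxOfEmb_apply`, `mem_galRange_iff_discr`).  This DISCHARGES the hypothesis
`hD` of the K-carrier localisation (`IwasawaCohomologyNumberFieldLoc.lean`) in the habitat. [cite: NeukirchANT1999, Ch. II (8.2)–(8.3)] [cite: Marcus1977, Ch. 3 Thm. 25] -/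
theorem resGalOfEmb_mem_galRange_of_split_two {K : Type} [Field K] [NumberField K] (h2 : Module.finrank ℚ K = 2)
    (hsplit : ((Ideal.span {(2 : ℤ)}).primesOver (𝓞 K)).ncard = 2)
    {v : HeightOneSpectrum (𝓞 ℚ)} (hv : ((Rat.HeightOneSpectrum.primesEquiv v : Nat.Primes) : ℕ) = 2)
    (g : absoluteGaloisGroup (v.adicCompletion ℚ)) :
    resGalOfEmb (closureEmb (K := ℚ) (v.adicCompletion ℚ)) g ∈ galRange (K := ℚ) K := by
  obtain ⟨t, ht⟩ := exists_sq_eq_discr_adicCompletion_two h2 hsplit hv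
  -- `ι(√d)` and `t` are both square roots of `d` in `\bar ℚ_v`
  have hs : (closureEmb (K := ℚ) (v.adicCompletion ℚ) (geomSqrt ((NumberField.discr K : ℤ) : ℚ))) ^ 2 =
      algebraMap ℚ (AlgebraicClosure (v.adicCompletion ℚ)) ((NumberField.discr K : ℤ) : ℚ) := by
    rw [← map_pow, geomSqrt_sq, AlgHom.commutes]
  have ht' : (algebraMap (v.adicCompletion ℚ) (AlgebraicClosure (v.adicCompletion ℚ)) t) ^ 2 =
      algebraMap ℚ (AlgebraicClosure (v.adicCompletion ℚ)) ((NumberField.discr K : ℤ) : ℚ) := by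
    rw [← map_pow, ht, ← IsScalarTower.algebraMap_apply]
  have hfix : (show AlgebraicClosure (v.adicCompletion ℚ) ≃ₐ[v.adicCompletion ℚ] AlgebraicClosure (v.adicCompletion ℚ) from g)
      (algebraMap (v.adicCompletion ℚ) (AlgebraicClosure (v.adicCompletion ℚ)) t) =
      algebraMap (v.adicCompletion ℚ) (AlgebraicClosure (v.adicCompletion ℚ)) t := AlgEquiv.commutes _ t
  have hgs : (show AlgebraicClosure (v.adicCompletion ℚ) ≃ₐ[v.adicCompletion ℚ] AlgebraicClosure (v.adicCompletion ℚ) from g)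
      (closureEmb (K := ℚ) (v.adicCompletion ℚ) (geomSqrt ((NumberField.discr K : ℤ) : ℚ))) =
      closureEmb (K := ℚ) (v.adicCompletion ℚ) (geomSqrt ((NumberField.discr K : ℤ) : ℚ)) := by
    rcases sq_eq_sq_iff_eq_or_eq_neg.mp (hs.trans ht'.symm) with h | h
    · rw [h, hfix]
    · rw [h, map_neg, hfix]
  rw [mem_galRange_iff_discr K h2]
  apply (closureEmb (K := ℚ) (v.adicCompletion ℚ)).toRingHom.injective
  exact (apply_resGalAuxOfEmb_apply (closureEmb (K := ℚ) (v.adicCompletion ℚ)) g _).trans hgs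

/-- `v ∣ 2` in the tree's two spellings: `(2 : 𝓞 ℚ) ∈ v` iff `primesEquiv v = 2`. [cite: NeukirchANT1999, Ch. I §8] -/
theorem primesEquiv_eq_two_of_mem {v : HeightOneSpectrum (𝓞 ℚ)} (hv : ((2 : ℕ) : 𝓞 ℚ) ∈ v.asIdeal) :
    ((Rat.HeightOneSpectrum.primesEquiv v : Nat.Primes) : ℕ) = 2 := by
  rw [Literature.NumberTheory.EllipticCurves.natCast_mem_asIdeal_iff_eq_primesEquiv_symm _ Nat.prime_two] at hv
  rw [hv, Equiv.apply_symm_apply]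

/-- **The Shapiro lattice with both clauses at `p = 2`, `v ∣ 2`, `hD` DISCHARGED from the Heegner hypothesis** — in the EXACT hypothesis
vocabulary of the lead's (PT) binder `TwoAdicShapiroPT.ShapiroLatticePoitouTateAtTwoTheta` (`IsImaginaryQuadratic K`, `SatisfiesHeegnerHypothesis 2 K`,
`C • A = W^{(d_K)}`, `κ` cyclotomic with generator `γ`, `(2 : 𝓞 ℚ) ∈ v`, local surjectivity/generator `hsurjv`, `hγᵥ`, pins `I_W, I_A, J, J_A`):
there are `u_A` with `u_A` BIJECTIVE, and `L` with `range_le` and `two_smul_mem`, `L` being `loc_w̄ 𝐇¹_{K,Γ}(T₂W_K)` (`range IK.locOver` for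
a `K`-pin `IK`, the split datum `hD` supplied).  What the binder asks BEYOND this file: the Poitou–Tate triple `(θ, δ, π)` over `J.H ⧸ L` and the
compact-Selmer clause `loc_injective` — the genuine (PT) content. [cite: GreenbergLNM1716, §4 p. 107] [cite: Kato2004Asterisque, §17.13 (17.13.1)] -/
theorem exists_shapiroLattice_two_of_heegner {K : Type} [Field K] [NumberField K] (hK : IsImaginaryQuadratic K)
    (hH : SatisfiesHeegnerHypothesis 2 K)
    {W A : WeierstrassCurve ℚ} [W.IsElliptic] [A.IsElliptic] [ContinuousSMul ℤ_[2] (W.tateModule 2)]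
    [ContinuousSMul ℤ_[2] (A.tateModule 2)] [ContinuousSMul ℤ_[2] ((W.baseChange K).tateModule 2)]
    (C : VariableChange ℚ) (hA : C • A = W.quadraticTwist ((NumberField.discr K : ℤ) : ℚ))
    {κ : ZpExtension ℚ 2} (hκ : κ.IsCyclotomic) {γ : absoluteGaloisGroup ℚ} (hγ : κ.IsTopGenerator γ)
    {v : HeightOneSpectrum (𝓞 ℚ)} (hv : ((2 : ℕ) : 𝓞 ℚ) ∈ v.asIdeal)
    {γᵥ : absoluteGaloisGroup (v.adicCompletion ℚ)}
    (hsurjv : Function.Surjective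
      (κ.toContinuousMonoidHom.comp (resGalOfEmb (closureEmb (K := ℚ) (v.adicCompletion ℚ)))))
    (hγᵥ : κ.IsTopGenerator (resGalOfEmb (closureEmb (K := ℚ) (v.adicCompletion ℚ)) γᵥ))
    (I_W : IwasawaH1Data W 2 κ γ) (I_A : IwasawaH1Data A 2 κ γ)
    (J : LocalIwasawaH1Data κ v ((tateRep W 2).toLocal v) γᵥ) (J_A : LocalIwasawaH1Data κ v ((tateRep A 2).toLocal v) γᵥ) :
    ∃ (hD : ∀ g : absoluteGaloisGroup (v.adicCompletion ℚ),
        resGalOfEmb (closureEmb (K := ℚ) (v.adicCompletion ℚ)) g ∈ galRange (K := ℚ) K)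
      (uA : ((tateRep A 2).toLocal v).toTopRep ⟶ ((tateRep W 2).toLocal v).toTopRep), Function.Bijective uA.hom ∧
      ∃ (L : Submodule (IwasawaAlgebra 2) J.H),
      LinearMap.range ((I_W.loc J hsurjv hγ hγᵥ).coprod (J_A.map uA J ∘ₗ I_A.loc J_A hsurjv hγ hγᵥ)) ≤ L ∧
      (∀ y ∈ L, (2 : IwasawaAlgebra 2) • y ∈
        LinearMap.range ((I_W.loc J hsurjv hγ hγᵥ).coprod (J_A.map uA J ∘ₗ I_A.loc J_A hsurjv hγ hγᵥ))) ∧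
      ∃ (h : Function.Surjective (κ.toContinuousMonoidHom.comp (absGaloisRestrict ℚ K)))
        (γK : absoluteGaloisGroup K) (hγK : (κ.restrict K h).IsTopGenerator γK)
        (IK : IwasawaH1DataOver (W.baseChange K) 2 (κ.restrict K h) γK), L = LinearMap.range (IK.locOver J hD hsurjv hγK hγᵥ) := by
  have hsplit : ((Ideal.span {(2 : ℤ)}).primesOver (𝓞 K)).ncard = 2 := by
    have := hH 2 Nat.prime_two (dvd_refl 2)
    simpa using this
  have hD : ∀ g : absoluteGaloisGroup (v.adicCompletion ℚ),
      resGalOfEmb (closureEmb (K := ℚ) (v.adicCompletion ℚ)) g ∈ galRange (K := ℚ) K :=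
    resGalOfEmb_mem_galRange_of_split_two hK.1 hsplit (primesEquiv_eq_two_of_mem hv)
  obtain ⟨uA, hbij, L, h1, h2', rest⟩ := exists_shapiroLattice_two hK C hA hκ hγ hD hsurjv hγᵥ I_W I_A J J_A
  exact ⟨hD, uA, hbij, L, h1, h2', rest⟩

end Split

end Summit.BirchSwinnertonDyer.BirchSwinnertonDyer.Theorems.TwoAdicShapiroLattice

end
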